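import Literature.NumberTheory.EllipticCurves.WeierstrassTransformationFive
import Literature.NumberTheory.EllipticCurves.ComplexMultiplicationSingularModuli
import HarnessLib

/-!
# Singular moduli of class number one: the rows `d = −7, −8, −11, −19`

Topic `NumberTheory/EllipticCurves`; continuation of `ComplexMultiplicationSingularModuli.lean`
(level 3 of the decomposition of the named fact
`Literature.NumberTheory.EllipticCurves.finite_point_of_j_mem_maximalCMJInvariants_of_L_one_ne_zero` = Coates–Wiles 1977, Thm. 1
for `F = ℚ`, composed with Mordell–Weil).  That file reduced the CM-period leaf to the named fact
`Literature.NumberTheory.EllipticCurves.singularModuli_classNumberOne` — the table `j(𝓞_K)` of the nine class-number-one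
imaginary quadratic orders (Cox, *Primes of the form x² + ny²*, §12.C, table (12.20)) — and proved
its rows `d = −3, −4`.  Here four more rows are **proved**, by the elementary method of Stark as
presented in Cox §10.C ((10.21)–(10.22): complex multiplication by an element `α` of norm `2`,
`3`, resp. `5`, and comparison of Laurent expansions of `℘(αz)` and `℘(z)`), formalised in
`WeierstrassTransformation.lean` and `WeierstrassTransformationFive.lean`
(`PeriodPair.j_eq_of_cmTwo_of_sq_eq_neg_two`, `PeriodPair.j_eq_of_cmTwo_of_sq_eq_self_sub_two`,
`PeriodPair.j_eq_of_cmThree_of_sq_eq_self_sub_three`,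
`PeriodPair.j_eq_of_cmFive_of_sq_eq_self_sub_five`):

* `Literature.NumberTheory.EllipticCurves.j_cmPeriodPair_neg_eight` : `j(Λ_{−8}) = j(ℤ[√−2]) = 8000 = 20³` (Cox §10.C,
  "`j(√−2) = 8000`"; table (12.20), row `d_K = −8`);
* `Literature.NumberTheory.EllipticCurves.j_cmPeriodPair_neg_seven` : `j(Λ_{−7}) = j(ℤ[(1 + √−7)/2]) = −3375 = (−15)³` (Cox
  §10.C and Exercise 10.20; table (12.20), row `d_K = −7`);
* `Literature.NumberTheory.EllipticCurves.j_cmPeriodPair_neg_eleven` : `j(Λ_{−11}) = j(ℤ[(1 + √−11)/2]) = −32768 = (−32)³`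
  (table (12.20), row `d_K = −11`);
* `Literature.NumberTheory.EllipticCurves.j_cmPeriodPair_neg_nineteen` : `j(Λ_{−19}) = j(ℤ[(1 + √−19)/2]) = −884736 = (−96)³`
  (table (12.20), row `d_K = −19`);
* `Literature.NumberTheory.EllipticCurves.cmTwo_neg_eight`, `Literature.NumberTheory.EllipticCurves.cmTwo_neg_seven`, `Literature.NumberTheory.EllipticCurves.cmThree_neg_eleven`,
  `Literature.NumberTheory.EllipticCurves.cmFive_neg_nineteen` : the lattices `Λ_d = ℤω_d + ℤ` (`Literature.NumberTheory.EllipticCurves.cmPeriodPair`,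
  `ω_d = (d + √d)/2`) have complex multiplication by `α = ω_{−8} + 4 = √−2`,
  `α = ω_{−7} + 4 = (1 + √−7)/2` (norm `2`: `α⁻¹Λ = Λ ∪ (w + Λ)`, `w = α/2`, resp. `(1 − α)/2`),
  `α = ω_{−11} + 6 = (1 + √−11)/2` (norm `3`: `α⁻¹Λ = Λ ∪ (±w + Λ)`, `w = (1 − α)/3`) and
  `α = ω_{−19} + 10 = (1 + √−19)/2` (norm `5`: `α⁻¹Λ = Λ ∪ (±w + Λ) ∪ (±2w + Λ)`,
  `w = (1 − α)/5`);
* `Literature.NumberTheory.EllipticCurves.singularModuli_classNumberOne_of_five`, `…_of_four`, `…_of_three` : the singular-moduli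
  fact now reduces to its three rows `d = −43, −67, −163`, isolated as the named fact
  `Literature.NumberTheory.EllipticCurves.singularModuli_classNumberOne_three` (the residual leaf);
* `Literature.NumberTheory.EllipticCurves.finite_point_of_j_mem_maximalCMJInvariants_of_L_one_ne_zero_of_five`, `…_of_four`,
  `…_of_three` : hence the target fact follows from the Coates–Wiles `𝔭`-divisibility fact
  (`CoatesWiles1977_L_one_div_period_mem_prime`), Deuring's `a_p = π + π̄`
  (`Deuring1941_frobeniusTrace_eq_add_conj`) and those three rows.

The remaining rows are not accessible by this method at reasonable cost (the CM element of least
norm has norm `11, 17, 41`; the `k`-torsion abscissae `℘(kw)`, `k ≤ 5, 8, 20`, enter, tied by the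
duplication relations); Cox obtains them from the integrality of `j(𝓞_K)` (Thm. 11.1) and
`q`-expansion estimates (§12.C, (12.21)–(12.23)), neither of which is in Mathlib.

## References

* D. A. Cox, *Primes of the form x² + ny²*, 2nd ed., Wiley 2013: §10.C eqs. (10.21)–(10.22)
  (PDF pp. 223–224), §10.D Exercises 10.19–10.20 (PDF p. 229), §12.C table (12.20)
  (PDF pp. 266–267).
* J. Coates, A. Wiles, *On the conjecture of Birch and Swinnerton-Dyer*, Invent. Math. 39 (1977),
  223–251, Thm. 1.
-/

noncomputable section

open Complex

/-! ### The rows `d = -8` and `d = -7` -/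

namespace Literature.NumberTheory.EllipticCurves

open PeriodPair

/-- Membership in `Λ_d = ℤω_d + ℤ` (`d < 0`). [folklore] -/
lemma mem_cmPeriodPair_lattice {d : ℤ} (hd : d < 0) {x : ℂ} :
    x ∈ (cmPeriodPair d).lattice ↔ ∃ m n : ℤ, (m : ℂ) * cmGen d + n = x := by
  rw [PeriodPair.mem_lattice, cmPeriodPair_ω₁ hd, cmPeriodPair_ω₂]
  simp only [mul_one]

/-- `I² = -1` in the form used by `linear_combination`. [folklore] -/
private lemma I_sq' : Complex.I ^ 2 = -1 := Complex.I_sq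

/-- `ω_{-8} + 4 = √-2`: `(ω_{-8} + 4)² = -2`. [folklore] -/
lemma cmGen_neg_eight_add_four_sq : (cmGen (-8) + 4) ^ 2 = -2 := by
  have h : Real.sqrt (-((-8 : ℤ) : ℝ)) = Real.sqrt 8 := by norm_num
  have h8 : ((Real.sqrt 8 : ℝ) : ℂ) ^ 2 = 8 := by
    rw [← Complex.ofReal_pow, Real.sq_sqrt (by norm_num)]; norm_num
  simp only [cmGen, h]
  push_cast
  linear_combination ((Real.sqrt 8 : ℂ) ^ 2 / 4) * I_sq' - h8 / 4

/-- `ω_{-8}² = -8ω_{-8} - 18`. [folklore] -/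
lemma cmGen_neg_eight_sq : cmGen (-8) ^ 2 = -8 * cmGen (-8) - 18 := by
  linear_combination cmGen_neg_eight_add_four_sq

/-- **`Λ_{-8} = ℤ[√-2]` has complex multiplication by `α = √-2` of degree two**:
`αx ∈ Λ ↔ x ∈ Λ ∨ x - α/2 ∈ Λ`, i.e. `α⁻¹Λ = Λ ∪ (α/2 + Λ)`. [folklore] -/
theorem cmTwo_neg_eight (x : ℂ) :
    (cmGen (-8) + 4) * x ∈ (cmPeriodPair (-8)).lattice ↔
      x ∈ (cmPeriodPair (-8)).lattice ∨ x - (cmGen (-8) + 4) / 2 ∈ (cmPeriodPair (-8)).lattice := by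
  have hd : (-8 : ℤ) < 0 := by norm_num
  have hω := cmGen_neg_eight_sq
  have hα := cmGen_neg_eight_add_four_sq
  set ω := cmGen (-8) with hωdef
  simp only [mem_cmPeriodPair_lattice hd]
  constructor
  · rintro ⟨m, n, h⟩
    have hx : x = -((ω + 4) / 2) * (m * ω + n) := by
      rw [h]; linear_combination (x / 2) * hα
    subst hx
    rcases Int.even_or_odd' n with ⟨k, rfl | rfl⟩
    · left
      refine ⟨2 * m - k, 9 * m - 4 * k, ?_⟩
      push_cast
      linear_combination ((m : ℂ) / 2) * hω
    · right
      refine ⟨2 * m - k - 1, 9 * m - 4 * k - 4, ?_⟩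
      push_cast
      linear_combination ((m : ℂ) / 2) * hω
  · rintro (⟨m, n, h⟩ | ⟨m, n, h⟩)
    · subst h
      refine ⟨-4 * m + n, -18 * m + 4 * n, ?_⟩
      push_cast
      linear_combination (-(m : ℂ)) * hω
    · have hx : x = m * ω + n + (ω + 4) / 2 := by linear_combination -h
      subst hx
      refine ⟨-4 * m + n, -18 * m + 4 * n - 1, ?_⟩
      push_cast
      linear_combination (-(m : ℂ) - 1 / 2) * hω

/-- `α/2 = √-2/2 ∉ Λ_{-8}`. [folklore] -/
lemma cmGen_neg_eight_add_four_div_two_notMem :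
    (cmGen (-8) + 4) / 2 ∉ (cmPeriodPair (-8)).lattice := by
  have hd : (-8 : ℤ) < 0 := by norm_num
  have : (cmGen (-8) + 4) / 2 =
      ((1 / 2 : ℚ) : ℂ) * (cmPeriodPair (-8)).ω₁ + ((2 : ℚ) : ℂ) * (cmPeriodPair (-8)).ω₂ := by
    rw [cmPeriodPair_ω₁ hd, cmPeriodPair_ω₂]; push_cast; ring
  rw [this, PeriodPair.mul_ω₁_add_mul_ω₂_mem_lattice]
  norm_num

/-- **Row `d = -8` of table (12.20): `j(ℤ[√-2]) = j(√-2) = 8000 = 20³`** — Cox §10,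
"we will follow the exposition of Stark and show that `j(√-2) = 8000`" ((10.21)–(10.22)), here
via `PeriodPair.j_eq_of_cmTwo_of_sq_eq_neg_two`.
[cite: Cox2013, §10 (10.21)–(10.22) (PDF pp. 223–224) and §12.C table (12.20) row d_K = -8] -/
theorem j_cmPeriodPair_neg_eight : (cmPeriodPair (-8)).j = 8000 :=
  PeriodPair.j_eq_of_cmTwo_of_sq_eq_neg_two cmGen_neg_eight_add_four_sq cmTwo_neg_eight
    cmGen_neg_eight_add_four_div_two_notMem

/-- `ω_{-7} + 4 = α = (1 + √-7)/2`: `α² = α - 2`. [folklore] -/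
lemma cmGen_neg_seven_add_four_sq : (cmGen (-7) + 4) ^ 2 = (cmGen (-7) + 4) - 2 := by
  have h : Real.sqrt (-((-7 : ℤ) : ℝ)) = Real.sqrt 7 := by norm_num
  have h7 : ((Real.sqrt 7 : ℝ) : ℂ) ^ 2 = 7 := by
    rw [← Complex.ofReal_pow, Real.sq_sqrt (by norm_num)]; norm_num
  simp only [cmGen, h]
  push_cast
  linear_combination ((Real.sqrt 7 : ℂ) ^ 2 / 4) * I_sq' - h7 / 4

/-- `ω_{-7}² = -7ω_{-7} - 14`. [folklore] -/
lemma cmGen_neg_seven_sq : cmGen (-7) ^ 2 = -7 * cmGen (-7) - 14 := by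
  linear_combination cmGen_neg_seven_add_four_sq

/-- **`Λ_{-7} = ℤ[(1 + √-7)/2]` has complex multiplication by `α = (1 + √-7)/2` of degree two**:
`αx ∈ Λ ↔ x ∈ Λ ∨ x - w ∈ Λ` with `w = ᾱ/2 = (1 - α)/2 = α⁻¹`, i.e. `α⁻¹Λ = Λ ∪ (w + Λ)`.
[folklore] -/
theorem cmTwo_neg_seven (x : ℂ) :
    (cmGen (-7) + 4) * x ∈ (cmPeriodPair (-7)).lattice ↔
      x ∈ (cmPeriodPair (-7)).lattice ∨
        x - (-3 - cmGen (-7)) / 2 ∈ (cmPeriodPair (-7)).lattice := by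
  have hd : (-7 : ℤ) < 0 := by norm_num
  have hω := cmGen_neg_seven_sq
  set ω := cmGen (-7) with hωdef
  simp only [mem_cmPeriodPair_lattice hd]
  constructor
  · rintro ⟨m, n, h⟩
    have hx : x = (-3 - ω) / 2 * (m * ω + n) := by
      rw [h]; linear_combination (x / 2) * hω
    subst hx
    rcases Int.even_or_odd' n with ⟨k, rfl | rfl⟩
    · left
      refine ⟨2 * m - k, 7 * m - 3 * k, ?_⟩
      push_cast
      linear_combination ((m : ℂ) / 2) * hω
    · right
      refine ⟨2 * m - k, 7 * m - 3 * k, ?_⟩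
      push_cast
      linear_combination ((m : ℂ) / 2) * hω
  · rintro (⟨m, n, h⟩ | ⟨m, n, h⟩)
    · subst h
      refine ⟨-3 * m + n, -14 * m + 4 * n, ?_⟩
      push_cast
      linear_combination (-(m : ℂ)) * hω
    · have hx : x = m * ω + n + (-3 - ω) / 2 := by linear_combination -h
      subst hx
      refine ⟨-3 * m + n, -14 * m + 4 * n + 1, ?_⟩
      push_cast
      linear_combination (-(m : ℂ) + 1 / 2) * hω

/-- `w = (1 - α)/2 ∉ Λ_{-7}`. [folklore] -/
lemma neg_three_sub_cmGen_neg_seven_div_two_notMem :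
    (-3 - cmGen (-7)) / 2 ∉ (cmPeriodPair (-7)).lattice := by
  have hd : (-7 : ℤ) < 0 := by norm_num
  have : (-3 - cmGen (-7)) / 2 =
      ((-1 / 2 : ℚ) : ℂ) * (cmPeriodPair (-7)).ω₁ + ((-3 / 2 : ℚ) : ℂ) * (cmPeriodPair (-7)).ω₂ := by
    rw [cmPeriodPair_ω₁ hd, cmPeriodPair_ω₂]; push_cast; ring
  rw [this, PeriodPair.mul_ω₁_add_mul_ω₂_mem_lattice]
  norm_num

/-- **Row `d = -7` of table (12.20): `j(ℤ[(1 + √-7)/2]) = j((1 + √-7)/2) = -3375 = (-15)³`** —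
Cox §10, "by a similar computation" (Exercise 10.20), here via
`PeriodPair.j_eq_of_cmTwo_of_sq_eq_self_sub_two`.
[cite: Cox2013, §10 Exercise 10.20 (PDF p. 224) and §12.C table (12.20) row d_K = -7] -/
theorem j_cmPeriodPair_neg_seven : (cmPeriodPair (-7)).j = -3375 :=
  PeriodPair.j_eq_of_cmTwo_of_sq_eq_self_sub_two cmGen_neg_seven_add_four_sq cmTwo_neg_seven
    neg_three_sub_cmGen_neg_seven_div_two_notMem

/-- `cmDiscr (-3375) = -7` (table lookup). [folklore] -/
lemma cmDiscr_neg_3375 : cmDiscr (-3375) = -7 := by norm_num [cmDiscr]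

/-- `cmDiscr 8000 = -8` (table lookup). [folklore] -/
lemma cmDiscr_8000 : cmDiscr 8000 = -8 := by norm_num [cmDiscr]

/-- **The singular-moduli fact reduces to its five rows `d = -11, -19, -43, -67, -163`**, the rows
`d = -3, -4, -7, -8` being proved (`j_cmPeriodPair_neg_three`, `_neg_four`, `_neg_seven`,
`_neg_eight`). [cite: Cox2013, §12.C table (12.20)] -/
theorem singularModuli_classNumberOne_of_five
    (h : ∀ j ∈ ({-32768, -884736, -884736000, -147197952000,
      -262537412640768000} : Finset ℚ), (cmPeriodPair (cmDiscr j)).j = (j : ℂ)) :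
    singularModuli_classNumberOne := by
  refine singularModuli_classNumberOne_of_seven fun j hj ↦ ?_
  simp only [Finset.mem_insert, Finset.mem_singleton] at hj
  rcases hj with rfl | rfl | rfl | rfl | rfl | rfl | rfl
  · rw [cmDiscr_neg_3375, j_cmPeriodPair_neg_seven]; norm_num
  · rw [cmDiscr_8000, j_cmPeriodPair_neg_eight]; norm_num
  all_goals exact h _ (by simp)

/-- **bsd.S28 (maximal-order CM Mordell–Weil part) from F1, F3 and five singular moduli**: the
target fact `finite_point_of_j_mem_maximalCMJInvariants_of_L_one_ne_zero` follows from the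
Coates–Wiles `𝔭`-divisibility fact `CoatesWiles1977_L_one_div_period_mem_prime`, Deuring's
`a_p = π + π̄` (`Deuring1941_frobeniusTrace_eq_add_conj`) and the five remaining rows
`d = -11, -19, -43, -67, -163` of the table of singular moduli.
[cite: CoatesWiles1977, Thm 1 (p. 223)] -/
theorem finite_point_of_j_mem_maximalCMJInvariants_of_L_one_ne_zero_of_five
    (h1 : CoatesWiles1977_L_one_div_period_mem_prime)
    (h2 : Deuring1941_frobeniusTrace_eq_add_conj)
    (h5 : ∀ j ∈ ({-32768, -884736, -884736000, -147197952000,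
      -262537412640768000} : Finset ℚ), (cmPeriodPair (cmDiscr j)).j = (j : ℂ)) :
    finite_point_of_j_mem_maximalCMJInvariants_of_L_one_ne_zero :=
  finite_point_of_j_mem_maximalCMJInvariants_of_L_one_ne_zero_of_singularModuli h1 h2
    (singularModuli_classNumberOne_of_five h5)


/-! ### The row `d = -11` -/

/-- `ω_{-11} + 6 = α = (1 + √-11)/2`: `α² = α - 3`. [folklore] -/
lemma cmGen_neg_eleven_add_six_sq : (cmGen (-11) + 6) ^ 2 = (cmGen (-11) + 6) - 3 := by
  have h : Real.sqrt (-((-11 : ℤ) : ℝ)) = Real.sqrt 11 := by norm_num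
  have h11 : ((Real.sqrt 11 : ℝ) : ℂ) ^ 2 = 11 := by
    rw [← Complex.ofReal_pow, Real.sq_sqrt (by norm_num)]; norm_num
  simp only [cmGen, h]
  push_cast
  linear_combination ((Real.sqrt 11 : ℂ) ^ 2 / 4) * Complex.I_sq - h11 / 4

/-- `ω_{-11}² = -11ω_{-11} - 33`. [folklore] -/
lemma cmGen_neg_eleven_sq : cmGen (-11) ^ 2 = -11 * cmGen (-11) - 33 := by
  linear_combination cmGen_neg_eleven_add_six_sq

/-- **`Λ_{-11} = ℤ[(1 + √-11)/2]` has complex multiplication by `α = (1 + √-11)/2` of degree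
three**: `αx ∈ Λ ↔ x ∈ Λ ∨ x - w ∈ Λ ∨ x + w ∈ Λ` with `w = ᾱ/3 = α⁻¹ = (-5 - ω_{-11})/3`, i.e.
`α⁻¹Λ = Λ ∪ (w + Λ) ∪ (-w + Λ)`. [folklore] -/
theorem cmThree_neg_eleven (x : ℂ) :
    (cmGen (-11) + 6) * x ∈ (cmPeriodPair (-11)).lattice ↔
      x ∈ (cmPeriodPair (-11)).lattice ∨
        x - (-5 - cmGen (-11)) / 3 ∈ (cmPeriodPair (-11)).lattice ∨
        x + (-5 - cmGen (-11)) / 3 ∈ (cmPeriodPair (-11)).lattice := by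
  have hd : (-11 : ℤ) < 0 := by norm_num
  have hω := cmGen_neg_eleven_sq
  set ω := cmGen (-11) with hωdef
  simp only [mem_cmPeriodPair_lattice hd]
  constructor
  · rintro ⟨m, n, h⟩
    have hx : x = (-5 - ω) / 3 * (m * ω + n) := by
      rw [h]; linear_combination (x / 3) * hω
    subst hx
    obtain ⟨k, r, rfl, hr⟩ : ∃ k r : ℤ, n = 3 * k + r ∧ (r = 0 ∨ r = 1 ∨ r = 2) :=
      ⟨n / 3, n % 3, by omega, by omega⟩
    rcases hr with rfl | rfl | rfl
    · left
      refine ⟨2 * m - k, 11 * m - 5 * k, ?_⟩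
      push_cast
      linear_combination ((m : ℂ) / 3) * hω
    · right; left
      refine ⟨2 * m - k, 11 * m - 5 * k, ?_⟩
      push_cast
      linear_combination ((m : ℂ) / 3) * hω
    · right; right
      refine ⟨2 * m - k - 1, 11 * m - 5 * k - 5, ?_⟩
      push_cast
      linear_combination ((m : ℂ) / 3) * hω
  · rintro (⟨m, n, h⟩ | ⟨m, n, h⟩ | ⟨m, n, h⟩)
    · subst h
      refine ⟨-5 * m + n, -33 * m + 6 * n, ?_⟩
      push_cast
      linear_combination (-(m : ℂ)) * hω
    · have hx : x = m * ω + n + (-5 - ω) / 3 := by linear_combination -h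
      subst hx
      refine ⟨-5 * m + n, -33 * m + 6 * n + 1, ?_⟩
      push_cast
      linear_combination (-(m : ℂ) + 1 / 3) * hω
    · have hx : x = m * ω + n - (-5 - ω) / 3 := by linear_combination -h
      subst hx
      refine ⟨-5 * m + n, -33 * m + 6 * n - 1, ?_⟩
      push_cast
      linear_combination (-(m : ℂ) - 1 / 3) * hω

/-- `w = (1 - α)/3 ∉ Λ_{-11}`. [folklore] -/
lemma cmThree_neg_eleven_w_notMem :
    (-5 - cmGen (-11)) / 3 ∉ (cmPeriodPair (-11)).lattice := by
  have hd : (-11 : ℤ) < 0 := by norm_num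
  have : (-5 - cmGen (-11)) / 3 =
      ((-1 / 3 : ℚ) : ℂ) * (cmPeriodPair (-11)).ω₁ + ((-5 / 3 : ℚ) : ℂ) * (cmPeriodPair (-11)).ω₂ := by
    rw [cmPeriodPair_ω₁ hd, cmPeriodPair_ω₂]; push_cast; ring
  rw [this, PeriodPair.mul_ω₁_add_mul_ω₂_mem_lattice]
  norm_num

/-- `2w ∉ Λ_{-11}`. [folklore] -/
lemma cmThree_neg_eleven_two_mul_w_notMem :
    2 * ((-5 - cmGen (-11)) / 3) ∉ (cmPeriodPair (-11)).lattice := by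
  have hd : (-11 : ℤ) < 0 := by norm_num
  have : 2 * ((-5 - cmGen (-11)) / 3) =
      ((-2 / 3 : ℚ) : ℂ) * (cmPeriodPair (-11)).ω₁ + ((-10 / 3 : ℚ) : ℂ) * (cmPeriodPair (-11)).ω₂ := by
    rw [cmPeriodPair_ω₁ hd, cmPeriodPair_ω₂]; push_cast; ring
  rw [this, PeriodPair.mul_ω₁_add_mul_ω₂_mem_lattice]
  norm_num

/-- **Row `d = -11` of table (12.20): `j(ℤ[(1 + √-11)/2]) = j((1 + √-11)/2) = -32768 = (-32)³`**,
here by the method of Cox §10.C for the CM element `(1 + √-11)/2` of norm `3`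
(`PeriodPair.j_eq_of_cmThree_of_sq_eq_self_sub_three`).
[cite: Cox2013, §12.C table (12.20) row d_K = -11] -/
theorem j_cmPeriodPair_neg_eleven : (cmPeriodPair (-11)).j = -32768 :=
  PeriodPair.j_eq_of_cmThree_of_sq_eq_self_sub_three cmGen_neg_eleven_add_six_sq
    cmThree_neg_eleven cmThree_neg_eleven_w_notMem cmThree_neg_eleven_two_mul_w_notMem

/-- `cmDiscr (-32768) = -11` (table lookup). [folklore] -/
lemma cmDiscr_neg_32768 : cmDiscr (-32768) = -11 := by norm_num [cmDiscr]

/-- **The singular-moduli fact reduces to its four rows `d = -19, -43, -67, -163`**, the rows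
`d = -3, -4, -7, -8, -11` being proved (`j_cmPeriodPair_neg_three`, `_neg_four`, `_neg_seven`,
`_neg_eight`, `_neg_eleven`). [cite: Cox2013, §12.C table (12.20)] -/
theorem singularModuli_classNumberOne_of_four
    (h : ∀ j ∈ ({-884736, -884736000, -147197952000,
      -262537412640768000} : Finset ℚ), (cmPeriodPair (cmDiscr j)).j = (j : ℂ)) :
    singularModuli_classNumberOne := by
  refine singularModuli_classNumberOne_of_five fun j hj ↦ ?_
  simp only [Finset.mem_insert, Finset.mem_singleton] at hj
  rcases hj with rfl | rfl | rfl | rfl | rfl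
  · rw [cmDiscr_neg_32768, j_cmPeriodPair_neg_eleven]; norm_num
  all_goals exact h _ (by simp)

/-- **bsd.S28 (maximal-order CM Mordell–Weil part) from F1, F3 and four singular moduli**: the
target fact `finite_point_of_j_mem_maximalCMJInvariants_of_L_one_ne_zero` follows from the
Coates–Wiles `𝔭`-divisibility fact `CoatesWiles1977_L_one_div_period_mem_prime`, Deuring's
`a_p = π + π̄` (`Deuring1941_frobeniusTrace_eq_add_conj`) and the four remaining rows
`d = -19, -43, -67, -163` of the table of singular moduli (`j = -96³, -960³, -5280³, -640320³`).
[cite: CoatesWiles1977, Thm 1 (p. 223)] -/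
theorem finite_point_of_j_mem_maximalCMJInvariants_of_L_one_ne_zero_of_four
    (h1 : CoatesWiles1977_L_one_div_period_mem_prime)
    (h2 : Deuring1941_frobeniusTrace_eq_add_conj)
    (h4 : ∀ j ∈ ({-884736, -884736000, -147197952000,
      -262537412640768000} : Finset ℚ), (cmPeriodPair (cmDiscr j)).j = (j : ℂ)) :
    finite_point_of_j_mem_maximalCMJInvariants_of_L_one_ne_zero :=
  finite_point_of_j_mem_maximalCMJInvariants_of_L_one_ne_zero_of_singularModuli h1 h2
    (singularModuli_classNumberOne_of_four h4)


/-! ### The row `d = -19` -/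

/-- `ω_{-19} + 10 = α = (1 + √-19)/2`: `α² = α - 5`. [folklore] -/
lemma cmGen_neg_nineteen_add_ten_sq : (cmGen (-19) + 10) ^ 2 = (cmGen (-19) + 10) - 5 := by
  have h : Real.sqrt (-((-19 : ℤ) : ℝ)) = Real.sqrt 19 := by norm_num
  have h19 : ((Real.sqrt 19 : ℝ) : ℂ) ^ 2 = 19 := by
    rw [← Complex.ofReal_pow, Real.sq_sqrt (by norm_num)]; norm_num
  simp only [cmGen, h]
  push_cast
  linear_combination ((Real.sqrt 19 : ℂ) ^ 2 / 4) * Complex.I_sq - h19 / 4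

/-- `ω_{-19}² = -19ω_{-19} - 95`. [folklore] -/
lemma cmGen_neg_nineteen_sq : cmGen (-19) ^ 2 = -19 * cmGen (-19) - 95 := by
  linear_combination cmGen_neg_nineteen_add_ten_sq

/-- **`Λ_{-19} = ℤ[(1 + √-19)/2]` has complex multiplication by `α = (1 + √-19)/2` of degree
five**: `αx ∈ Λ ↔ x ∈ Λ ∪ (±w + Λ) ∪ (±2w + Λ)` with `w = ᾱ/5 = α⁻¹ = (-9 - ω_{-19})/5`.
[folklore] -/
theorem cmFive_neg_nineteen (x : ℂ) :
    (cmGen (-19) + 10) * x ∈ (cmPeriodPair (-19)).lattice ↔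
      x ∈ (cmPeriodPair (-19)).lattice ∨
        x - (-9 - cmGen (-19)) / 5 ∈ (cmPeriodPair (-19)).lattice ∨
        x + (-9 - cmGen (-19)) / 5 ∈ (cmPeriodPair (-19)).lattice ∨
        x - 2 * ((-9 - cmGen (-19)) / 5) ∈ (cmPeriodPair (-19)).lattice ∨
        x + 2 * ((-9 - cmGen (-19)) / 5) ∈ (cmPeriodPair (-19)).lattice := by
  have hd : (-19 : ℤ) < 0 := by norm_num
  have hω := cmGen_neg_nineteen_sq
  set ω := cmGen (-19) with hωdef
  simp only [mem_cmPeriodPair_lattice hd]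
  constructor
  · rintro ⟨m, n, h⟩
    have hx : x = (-9 - ω) / 5 * (m * ω + n) := by
      rw [h]; linear_combination (x / 5) * hω
    subst hx
    obtain ⟨k, r, rfl, hr⟩ : ∃ k r : ℤ, n = 5 * k + r ∧ (r = 0 ∨ r = 1 ∨ r = 2 ∨ r = 3 ∨ r = 4) :=
      ⟨n / 5, n % 5, by omega, by omega⟩
    rcases hr with rfl | rfl | rfl | rfl | rfl
    · left
      refine ⟨2 * m - k, 19 * m - 9 * k, ?_⟩
      push_cast
      linear_combination ((m : ℂ) / 5) * hω
    · right; left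
      refine ⟨2 * m - k, 19 * m - 9 * k, ?_⟩
      push_cast
      linear_combination ((m : ℂ) / 5) * hω
    · right; right; right; left
      refine ⟨2 * m - k, 19 * m - 9 * k, ?_⟩
      push_cast
      linear_combination ((m : ℂ) / 5) * hω
    · right; right; right; right
      refine ⟨2 * m - k - 1, 19 * m - 9 * k - 9, ?_⟩
      push_cast
      linear_combination ((m : ℂ) / 5) * hω
    · right; right; left
      refine ⟨2 * m - k - 1, 19 * m - 9 * k - 9, ?_⟩
      push_cast
      linear_combination ((m : ℂ) / 5) * hω
  · rintro (⟨m, n, h⟩ | ⟨m, n, h⟩ | ⟨m, n, h⟩ | ⟨m, n, h⟩ | ⟨m, n, h⟩)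
    · subst h
      refine ⟨-9 * m + n, -95 * m + 10 * n, ?_⟩
      push_cast
      linear_combination (-(m : ℂ)) * hω
    · have hx : x = m * ω + n + (-9 - ω) / 5 := by linear_combination -h
      subst hx
      refine ⟨-9 * m + n, -95 * m + 10 * n + 1, ?_⟩
      push_cast
      linear_combination (-(m : ℂ) + 1 / 5) * hω
    · have hx : x = m * ω + n - (-9 - ω) / 5 := by linear_combination -h
      subst hx
      refine ⟨-9 * m + n, -95 * m + 10 * n - 1, ?_⟩
      push_cast
      linear_combination (-(m : ℂ) - 1 / 5) * hω
    · have hx : x = m * ω + n + 2 * ((-9 - ω) / 5) := by linear_combination -h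
      subst hx
      refine ⟨-9 * m + n, -95 * m + 10 * n + 2, ?_⟩
      push_cast
      linear_combination (-(m : ℂ) + 2 / 5) * hω
    · have hx : x = m * ω + n - 2 * ((-9 - ω) / 5) := by linear_combination -h
      subst hx
      refine ⟨-9 * m + n, -95 * m + 10 * n - 2, ?_⟩
      push_cast
      linear_combination (-(m : ℂ) - 2 / 5) * hω

/-- `kw ∉ Λ_{-19}` for `k = 1, 2, 3, 4` (`w = (1 - α)/5`). [folklore] -/
lemma cmFive_neg_nineteen_mul_w_notMem {k : ℕ} (hk : k = 1 ∨ k = 2 ∨ k = 3 ∨ k = 4) :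
    (k : ℂ) * ((-9 - cmGen (-19)) / 5) ∉ (cmPeriodPair (-19)).lattice := by
  have hd : (-19 : ℤ) < 0 := by norm_num
  have : (k : ℂ) * ((-9 - cmGen (-19)) / 5) = ((-(k : ℚ) / 5 : ℚ) : ℂ) * (cmPeriodPair (-19)).ω₁ +
      ((-(9 * k : ℚ) / 5 : ℚ) : ℂ) * (cmPeriodPair (-19)).ω₂ := by
    rw [cmPeriodPair_ω₁ hd, cmPeriodPair_ω₂]; push_cast; ring
  rw [this, PeriodPair.mul_ω₁_add_mul_ω₂_mem_lattice]
  rcases hk with rfl | rfl | rfl | rfl <;> norm_num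

/-- **Row `d = -19` of table (12.20): `j(ℤ[(1 + √-19)/2]) = j((1 + √-19)/2) = -884736 = (-96)³`**,
here by the method of Cox §10.C for the CM element `(1 + √-19)/2` of norm `5`
(`PeriodPair.j_eq_of_cmFive_of_sq_eq_self_sub_five`).
[cite: Cox2013, §12.C table (12.20) row d_K = -19] -/
theorem j_cmPeriodPair_neg_nineteen : (cmPeriodPair (-19)).j = -884736 := by
  have h1 := cmFive_neg_nineteen_mul_w_notMem (k := 1) (by norm_num)
  have h2 := cmFive_neg_nineteen_mul_w_notMem (k := 2) (by norm_num)
  have h3 := cmFive_neg_nineteen_mul_w_notMem (k := 3) (by norm_num)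
  have h4 := cmFive_neg_nineteen_mul_w_notMem (k := 4) (by norm_num)
  push_cast at h1 h2 h3 h4
  rw [one_mul] at h1
  exact PeriodPair.j_eq_of_cmFive_of_sq_eq_self_sub_five cmGen_neg_nineteen_add_ten_sq
    cmFive_neg_nineteen h1 h2 h3 h4

/-- `cmDiscr (-884736) = -19` (table lookup). [folklore] -/
lemma cmDiscr_neg_884736 : cmDiscr (-884736) = -19 := by norm_num [cmDiscr]

/-- **The three remaining singular moduli** (named fact, the residual leaf of the decomposition):
the rows `d_K = -43, -67, -163` of Cox's table (12.20), `j(𝓞_K) = -960³ = -884736000`,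
`-5280³ = -147197952000`, `-640320³ = -262537412640768000`, stated as `j(Λ_{d(j)}) = j` for these
three `j` (cf. `singularModuli_classNumberOne`, of which this is the restriction; the other six rows
are theorems).  Cox proves them from the integrality of `j(𝓞_K)` (Thm. 11.1) and the `q`-expansion
estimates (12.21)–(12.23); the CM elements of least norm have norm `11, 17, 41`, out of reach of the
elementary method of §10.C used for the other rows. [cite: Cox2013, §12.C table (12.20) rows d_K = -43, -67, -163] -/
def singularModuli_classNumberOne_three : Prop :=
  ∀ j ∈ ({-884736000, -147197952000, -262537412640768000} : Finset ℚ),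
    (cmPeriodPair (cmDiscr j)).j = (j : ℂ)

/-- **The singular-moduli fact reduces to its three rows `d = -43, -67, -163`**
(`singularModuli_classNumberOne_three`), the rows `d = -3, -4, -7, -8, -11, -19` being proved.
[cite: Cox2013, §12.C table (12.20)] -/
theorem singularModuli_classNumberOne_of_three (h : singularModuli_classNumberOne_three) :
    singularModuli_classNumberOne := by
  refine singularModuli_classNumberOne_of_four fun j hj ↦ ?_
  simp only [Finset.mem_insert, Finset.mem_singleton] at hj
  rcases hj with rfl | rfl | rfl | rfl
  · rw [cmDiscr_neg_884736, j_cmPeriodPair_neg_nineteen]; norm_num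
  all_goals exact h _ (by simp)

/-- **bsd.S28 (maximal-order CM Mordell–Weil part) from F1, F3 and three singular moduli**: the
target fact `finite_point_of_j_mem_maximalCMJInvariants_of_L_one_ne_zero` follows from the
Coates–Wiles `𝔭`-divisibility fact `CoatesWiles1977_L_one_div_period_mem_prime`, Deuring's
`a_p = π + π̄` (`Deuring1941_frobeniusTrace_eq_add_conj`) and the three remaining rows
`d = -43, -67, -163` of the table of singular moduli (`j = -960³, -5280³, -640320³`).
[cite: CoatesWiles1977, Thm 1 (p. 223)] -/
theorem finite_point_of_j_mem_maximalCMJInvariants_of_L_one_ne_zero_of_three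
    (h1 : CoatesWiles1977_L_one_div_period_mem_prime)
    (h2 : Deuring1941_frobeniusTrace_eq_add_conj)
    (h3 : singularModuli_classNumberOne_three) :
    finite_point_of_j_mem_maximalCMJInvariants_of_L_one_ne_zero :=
  finite_point_of_j_mem_maximalCMJInvariants_of_L_one_ne_zero_of_singularModuli h1 h2
    (singularModuli_classNumberOne_of_three h3)

end Literature.NumberTheory.EllipticCurves

end
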